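import Literature.IUT.LogVolume.Corollary22Legendre
import Literature.IUT.LogVolume.Theorem110
import HarnessLib

/-!
# [IUTchIV] Cor. 2.2 (ii): the interface `Thm110Legendre` FROM the typed Theorem 1.10
# (`Thm110Numerics.theorem110`) — the kernel edge "Cor. 3.12 + log-volume proof data at the point ⟹
# Thm110Legendre"

Mochizuki, *Inter-universal Teichmüller theory IV*, RIMS manuscript (Apr. 2020; = PRIMS **57** (2021)),
Thm. 1.10 pp. 22–31, Cor. 2.2 (ii) p. 46. PROOF-ONLY file (no definitions). TAKES NO SIDE on the disputed
step: [IUTchIII] Cor. 3.12 enters only as the field `Thm110Numerics.Cor312` of the hypothesis, never asserted.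

The tree proves Theorem 1.10's displayed inequality from its printed proof data (`Thm110Numerics.theorem110`,
abc-iut-S3: `ProofData` + `IsEtaPrm η_prm` + `l ≠ 5` + `Cor312` ⟹ `Display`, with `C_Θ` verbatim). The
interface `Cor22.Thm110Legendre` (what the proof of Cor. 2.2 (ii) takes from Thm. 1.10, p. 46 l. 1) is stated
over the `λ`-line. This file records the EDGE between the two: `Thm110Legendre` follows as soon as, for every
admissible `(λ, l)` (minimal presentation, `l ≥ 7` prime, `E` admits a core, (P2), (P5), (P6)), one has the
numbers `X : Thm110Numerics` OF THAT POINT — `X.l = l`, `X.η_prm = η_prm`, `X.d_mod = [ℚ(j(λ)):ℚ]`,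
`X.log(q) = log(q^{∤2l}(λ))`, `X.log(𝔡^{F_tpd}) = log-diff_X(λ)`, `X.log(𝔣^{F_tpd}) = log 𝔣^{∤2l}(λ)` — with
its proof data (Steps (ii)–(vii): the fields of `ProofData`, the log-volume computation at the initial Θ-data
(P7)) and `Cor312` for it (`thm110Legendre_of_numerics`); the case `l = 5` of `Thm110Legendre` is vacuous
once `¬ CondP6 P 5` (the `5`-torsion is rational over the theta-field, Thm. 1.10 p. 22 "`l ≠ 5`"), taken here
as the hypothesis `h5`. The passage `e*_mod ≤ d*_mod` (p. 46 l. 1) is `display_of_numerics`.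
-/

noncomputable section

namespace Literature.IUT.LogVolume

namespace Cor22

open NumberField Literature.NumberTheory.DiophantineGeometry.GenEll

/-- **p. 46 l. 1, "`20·(e*_mod·l + η_prm) ≤ 20·(d*_mod·l + η_prm)`"**: the display of Theorem 1.10 for numbers
`X` attached to the point `(λ, l)` implies `Cor22.Display P l η` (`e_mod ≤ d_mod`, p. 22).
[claim: Mochizuki2012, status: disputed] -/
theorem display_of_numerics {P : NFPoint} {l : ℕ} {η : ℝ} (X : Thm110Numerics) (hl : X.l = l)
    (hη : X.etaPrm = η) (hd : X.dmod = dmod P) (hq : X.logq = logQAvoid P {2, l})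
    (hD : X.logDiffTpd = P.logDiff) (hC : X.logCondTpd = logCondAvoid P {2, l}) (hdisp : X.Display) :
    Display P l η := by
  unfold Thm110Numerics.Display at hdisp
  unfold Display
  have he : (X.estar : ℝ) ≤ 2 ^ 12 * 3 ^ 3 * 5 * (dmod P : ℝ) := by
    have h1 : X.estar ≤ 2 ^ 12 * 3 ^ 3 * 5 * X.dmod := by
      unfold Thm110Numerics.estar
      exact Nat.mul_le_mul_left _ X.emod_le_dmod
    rw [← hd]
    exact_mod_cast h1
  have hl0 : (0 : ℝ) ≤ (l : ℝ) := Nat.cast_nonneg l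
  rw [hl, hη, hd, hq, hD, hC] at hdisp
  have hmul : (X.estar : ℝ) * l ≤ 2 ^ 12 * 3 ^ 3 * 5 * (dmod P : ℝ) * l :=
    mul_le_mul_of_nonneg_right he hl0
  linarith

/-- **`Thm110Legendre` from Theorem 1.10 at the numbers of the point** (the kernel edge [IUTchIV] Thm. 1.10 ⟹
what Cor. 2.2 (ii) consumes, p. 46: "In light of (P7), we may apply Theorem 1.10 … to conclude that
`(1/6)·log(q) ≤ (1 + 20·d_mod/l)·(log(𝔡^{F_tpd}) + log(𝔣^{F_tpd})) + 20·(d*_mod·l + η_prm)`"): if for every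
admissible `(λ, l)` with `l ≥ 7` there are numbers `X : Thm110Numerics` of the point carrying Theorem 1.10's
proof data and the Cor. 3.12 inequality `Cor312` (HYPOTHESIS `hnum` — this is where the initial Θ-data (P7),
the log-volume computations and [IUTchIII] Cor. 3.12 enter), and if `CondP6 P 5` never holds (`h5`: the
`5`-torsion of `E_F` is rational over `F`, so the image mod `5` is trivial — Thm. 1.10, p. 22, "`l ≠ 5`"), then
`Thm110Legendre`, via `Thm110Numerics.theorem110`. [claim: Mochizuki2012, status: disputed] -/
theorem thm110Legendre_of_numerics
    (h5 : ∀ P : NFPoint, P ∈ UP → ¬ CondP6 P 5)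
    (hnum : ∀ η : ℝ, IsEtaPrm η → ∀ P : NFPoint, P ∈ UP → ∀ l : ℕ, l.Prime → 7 ≤ l →
      AdmitsCore P → CondP2 P l → CondP5 P l → CondP6 P l →
      ∃ X : Thm110Numerics, X.l = l ∧ X.etaPrm = η ∧ X.dmod = dmod P ∧ X.logq = logQAvoid P {2, l} ∧
        X.logDiffTpd = P.logDiff ∧ X.logCondTpd = logCondAvoid P {2, l} ∧
        Nonempty X.ProofData ∧ X.Cor312) :
    Thm110Legendre := by
  intro η hη P hP l hl hl5 hcore h2 hP5 h6
  by_cases heq : l = 5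
  · subst heq
    exact absurd h6 (h5 P hP)
  have hl6 : l ≠ 6 := by
    rintro rfl
    exact absurd hl (by decide)
  have hl7 : 7 ≤ l := by omega
  obtain ⟨X, hXl, hXη, hXd, hXq, hXD, hXC, ⟨PD⟩, hcor⟩ := hnum η hη P hP l hl hl7 hcore h2 hP5 h6
  have hη' : IsEtaPrm X.etaPrm := by rw [hXη]; exact hη
  have hne : X.l ≠ 5 := by rw [hXl]; exact heq
  have hdisp := (Thm110Numerics.theorem110 PD hη' hne hcor).2.2.1
  exact display_of_numerics X hXl hXη hXd hXq hXD hXC hdisp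

end Cor22

end Literature.IUT.LogVolume

end
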